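/-
Origin: expansion seat `planner-pub-hodgecm-pv14-g6-0`, handover import Pv14g6.SchwartzLinearFlowDeriv -> import HodgeCM.Automorphic.SchwartzLinearFlowDeriv ; after SchwartzLinearFlowDeriv (this seat t31 row 1, same run) (`HOME/pub-hodgecm-pv14-g6/lean/Pv14g6/SchwartzFlowProductRule.lean`, md5 a4fbf2e6, 228 lines);
landed by the gen-8 packager in gate run 31 as `HodgeCM/Automorphic/SchwartzFlowProductRule.lean` (import ^import Pv14g6\.SchwartzLinearFlowDeriv[ \t]*$→import HodgeCM.Automorphic.SchwartzLinearFlowDeriv ×1).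
-/
/-
Copyright: HodgeCM public adjudication package, seat pub-hodgecm-pv14-g6 (DAG-NODE PROVER #14, gen 6).
File #17 of this seat.  Kernel-checked, no new axioms.  Imports file #16 of this seat
(`SchwartzLinearFlowDeriv`) and Mathlib only.
-/
import Summits.HodgeConjecture.HodgeCM.Automorphic.SchwartzLinearFlowDeriv_2

/-!
# A product rule for strongly differentiable operator families on Schwartz space

The smooth-vector statements of this seat (`SchwartzMultiplierDeriv`, `SchwartzTranslationDeriv`,
`SchwartzLinearFlowDeriv`) each treat ONE kind of one-parameter family acting on `𝓢(E, F)`: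
multipliers, translations, linear changes of variables.  A parabolic direction of the oscillator /
metaplectic representation is a COMPOSITE of such families, so consumers need a product rule at the
level of difference quotients in the Fréchet space `𝓢(E, F)` (where `HasDerivAt` is not available,
`𝓢` not being normed).  This file proves it, with hypotheses that the files above verify:

* `tendsto_comp_sub_div` : if `U : ℝ → (𝓢 →L[ℝ] 𝓢)` is *locally equicontinuous* near `t = 0`
  (every Schwartz seminorm of `U t Ψ` bounded by finitely many seminorms of `Ψ`, uniformly for `t`
  near `0`), `U t Y → Y`, `t⁻¹ • (U t Φ - Φ) → X` and `t⁻¹ • (w t - Φ) → Y`, then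
  `t⁻¹ • (U t (w t) - Φ) → X + Y` in `𝓢(E, F)`;
* `eventually_seminorm_compCLM_le`, `tendsto_compCLM_of_tendsto_one` : the composition operators
  `Φ ↦ Φ ∘ L t` of a family of linear automorphisms with `L t → 1` (operator norm) are locally
  equicontinuous and strongly continuous on `𝓢(E, F)` — from the quantitative estimate
  `seminorm_compCLM_sub_le` of file #16;
* `tendsto_compCLM_apply_sub_div` : hence, for `L` differentiable at `0` with `L 0 = 1`, `L'(0) = A`,
  and ANY trajectory `w` with `t⁻¹ • (w t - Φ) → Y`,
  `t⁻¹ • ((w t) ∘ L t - Φ) → flowGen A Φ + Y` in `𝓢(E, F)`.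

Only published mathematics is used (Mathlib); nothing here refers to the objects under adjudication.
-/

noncomputable section

open Filter Topology
open scoped SchwartzMap

namespace HodgeCM
namespace SchwartzWeil

variable {E F : Type*} [NormedAddCommGroup E] [NormedSpace ℝ E] [NormedAddCommGroup F]
  [NormedSpace ℝ F]

/-! ## The abstract product rule -/

/-- A locally equicontinuous family applied to a null net gives a null net. -/
theorem tendsto_apply_zero_of_equicontinuous {ι : Type*} {l : Filter ι}
    {U : ι → (𝓢(E, F) →L[ℝ] 𝓢(E, F))} {g : ι → 𝓢(E, F)}
    (hUeq : ∀ k n : ℕ, ∃ s : Finset (ℕ × ℕ), ∃ C : ℝ, ∀ᶠ t in l, ∀ Ψ : 𝓢(E, F),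
      SchwartzMap.seminorm ℝ k n (U t Ψ) ≤ C * ∑ i ∈ s, SchwartzMap.seminorm ℝ i.1 i.2 Ψ)
    (hg : Tendsto g l (𝓝 0)) : Tendsto (fun t => U t (g t)) l (𝓝 0) := by
  rw [(schwartz_withSeminorms ℝ E F).tendsto_nhds]
  rintro ⟨k, n⟩ ε hε
  obtain ⟨s, C, hC⟩ := hUeq k n
  have hi : ∀ i : ℕ × ℕ, Tendsto (fun t => SchwartzMap.seminorm ℝ i.1 i.2 (g t)) l (𝓝 0) := by
    intro i
    have hc := ((schwartz_withSeminorms ℝ E F).continuous_seminorm i).tendsto (0 : 𝓢(E, F))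
    rw [SchwartzMap.schwartzSeminormFamily_apply, map_zero] at hc
    exact hc.comp hg
  have hsum : Tendsto (fun t => C * ∑ i ∈ s, SchwartzMap.seminorm ℝ i.1 i.2 (g t)) l (𝓝 0) := by
    have h := (tendsto_finsetSum s fun i _ => hi i).const_mul C
    simpa only [Finset.sum_const_zero, mul_zero] using h
  filter_upwards [hC, hsum.eventually_lt_const hε] with t htC hlt
  rw [SchwartzMap.schwartzSeminormFamily_apply, sub_zero]
  exact (htC (g t)).trans_lt hlt

/-- **Product rule for difference quotients in `𝓢(E, F)`.**  `U` a locally equicontinuous family of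
continuous linear operators near `t = 0` with `U t Y → Y`; if `t⁻¹ • (U t Φ - Φ) → X` and
`t⁻¹ • (w t - Φ) → Y` then `t⁻¹ • (U t (w t) - Φ) → X + Y` (all limits in the Schwartz topology,
`t → 0`, `t ≠ 0`). -/
theorem tendsto_comp_sub_div {U : ℝ → (𝓢(E, F) →L[ℝ] 𝓢(E, F))} {w : ℝ → 𝓢(E, F)}
    {Φ X Y : 𝓢(E, F)}
    (hUeq : ∀ k n : ℕ, ∃ s : Finset (ℕ × ℕ), ∃ C : ℝ, ∀ᶠ t in 𝓝[≠] (0 : ℝ), ∀ Ψ : 𝓢(E, F),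
      SchwartzMap.seminorm ℝ k n (U t Ψ) ≤ C * ∑ i ∈ s, SchwartzMap.seminorm ℝ i.1 i.2 Ψ)
    (hUY : Tendsto (fun t => U t Y) (𝓝[≠] 0) (𝓝 Y))
    (hU : Tendsto (fun t : ℝ => t⁻¹ • (U t Φ - Φ)) (𝓝[≠] 0) (𝓝 X))
    (hw : Tendsto (fun t : ℝ => t⁻¹ • (w t - Φ)) (𝓝[≠] 0) (𝓝 Y)) :
    Tendsto (fun t : ℝ => t⁻¹ • (U t (w t) - Φ)) (𝓝[≠] 0) (𝓝 (X + Y)) := by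
  have hq0 : Tendsto (fun t : ℝ => t⁻¹ • (w t - Φ) - Y) (𝓝[≠] 0) (𝓝 0) := by
    rw [← sub_self Y]
    exact hw.sub tendsto_const_nhds
  have hA := tendsto_apply_zero_of_equicontinuous hUeq hq0
  have hsum := (hA.add hUY).add hU
  rw [zero_add, add_comm Y X] at hsum
  refine hsum.congr fun t => ?_
  simp only [map_sub, map_smul, smul_sub]
  abel

/-! ## Composition operators are locally equicontinuous and strongly continuous -/

section Comp

variable (𝕜 : Type*) [RCLike 𝕜] [NormedSpace 𝕜 F] [SMulCommClass ℝ 𝕜 F]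

/-- Seminorms of `Φ ∘ L` for `L` near the identity: `p_{k,n}(Φ ∘ L) ≤ 2^{n+k+1} p_{k+1,n+1}(Φ) +
(n 2^n + 1) p_{k,n}(Φ)` whenever `‖L - 1‖ ≤ 1/2`. -/
theorem seminorm_compCLM_le_of_near_one (L : E ≃L[ℝ] E) (hL : ‖(L : E →L[ℝ] E) - 1‖ ≤ 1 / 2)
    (k n : ℕ) (Φ : 𝓢(E, F)) :
    SchwartzMap.seminorm ℝ k n (SchwartzMap.compCLMOfContinuousLinearEquiv 𝕜 L Φ)
      ≤ 2 ^ (n + k + 1) * SchwartzMap.seminorm ℝ (k + 1) (n + 1) Φ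
        + (n * 2 ^ n + 1) * SchwartzMap.seminorm ℝ k n Φ := by
  set Ψ := SchwartzMap.compCLMOfContinuousLinearEquiv 𝕜 L Φ
  have h1 : SchwartzMap.seminorm ℝ k n Ψ ≤ SchwartzMap.seminorm ℝ k n (Ψ - Φ)
      + SchwartzMap.seminorm ℝ k n Φ := by
    calc SchwartzMap.seminorm ℝ k n Ψ = SchwartzMap.seminorm ℝ k n ((Ψ - Φ) + Φ) := by
          rw [sub_add_cancel]
      _ ≤ _ := map_add_le_add _ _ _
  have h2 := seminorm_compCLM_sub_le Φ 𝕜 L hL k n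
  have hA : 0 ≤ 2 ^ (n + k + 1) * SchwartzMap.seminorm ℝ (k + 1) (n + 1) Φ
      + n * 2 ^ n * SchwartzMap.seminorm ℝ k n Φ := by
    have := apply_nonneg (SchwartzMap.seminorm ℝ (k + 1) (n + 1)) Φ
    have := apply_nonneg (SchwartzMap.seminorm ℝ k n) Φ
    positivity
  have h3 : SchwartzMap.seminorm ℝ k n (Ψ - Φ) ≤ 2 ^ (n + k + 1) * SchwartzMap.seminorm ℝ (k + 1) (n + 1) Φ
      + n * 2 ^ n * SchwartzMap.seminorm ℝ k n Φ := by
    refine h2.trans ?_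
    calc _ ≤ (2 ^ (n + k + 1) * SchwartzMap.seminorm ℝ (k + 1) (n + 1) Φ
          + n * 2 ^ n * SchwartzMap.seminorm ℝ k n Φ) * 1 := by
          gcongr
          linarith [norm_nonneg ((L : E →L[ℝ] E) - 1)]
      _ = _ := mul_one _
  linarith

/-- **Local equicontinuity of composition operators**: if `L t → 1` in operator norm along a filter
`l`, then for every `(k, n)` the seminorm `p_{k,n}(Φ ∘ L t)` is eventually bounded by
`C (p_{k,n}(Φ) + p_{k+1,n+1}(Φ))`, uniformly in `Φ`. -/
theorem eventually_seminorm_compCLM_le {ι : Type*} {l : Filter ι} {L : ι → (E ≃L[ℝ] E)}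
    (hLc : Tendsto (fun t => ((L t : E ≃L[ℝ] E) : E →L[ℝ] E)) l (𝓝 1)) (k n : ℕ) :
    ∃ s : Finset (ℕ × ℕ), ∃ C : ℝ, ∀ᶠ t in l, ∀ Ψ : 𝓢(E, F),
      SchwartzMap.seminorm ℝ k n (SchwartzMap.compCLMOfContinuousLinearEquiv 𝕜 (L t) Ψ)
        ≤ C * ∑ i ∈ s, SchwartzMap.seminorm ℝ i.1 i.2 Ψ := by
  classical
  refine ⟨{(k, n), (k + 1, n + 1)}, 2 ^ (n + k + 1) + (n * 2 ^ n + 1), ?_⟩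
  have hsmall : ∀ᶠ t in l, ‖((L t : E ≃L[ℝ] E) : E →L[ℝ] E) - 1‖ ≤ 1 / 2 := by
    have h := (tendsto_iff_norm_sub_tendsto_zero.mp hLc).eventually_le_const
      (show (0 : ℝ) < 1 / 2 by norm_num)
    exact h
  filter_upwards [hsmall] with t ht Ψ
  have hne : (k, n) ≠ (k + 1, n + 1) := by simp
  rw [Finset.sum_pair hne]
  have hp0 := apply_nonneg (SchwartzMap.seminorm ℝ k n) Ψ
  have hp1 := apply_nonneg (SchwartzMap.seminorm ℝ (k + 1) (n + 1)) Ψ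
  calc _ ≤ 2 ^ (n + k + 1) * SchwartzMap.seminorm ℝ (k + 1) (n + 1) Ψ
        + (n * 2 ^ n + 1) * SchwartzMap.seminorm ℝ k n Ψ :=
        seminorm_compCLM_le_of_near_one 𝕜 (L t) ht k n Ψ
    _ = (2 ^ (n + k + 1) + (n * 2 ^ n + 1))
        * (SchwartzMap.seminorm ℝ k n Ψ + SchwartzMap.seminorm ℝ (k + 1) (n + 1) Ψ)
        - (2 ^ (n + k + 1) * SchwartzMap.seminorm ℝ k n Ψ
          + (n * 2 ^ n + 1) * SchwartzMap.seminorm ℝ (k + 1) (n + 1) Ψ) := by ring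
    _ ≤ (2 ^ (n + k + 1) + (n * 2 ^ n + 1))
        * (SchwartzMap.seminorm ℝ k n Ψ + SchwartzMap.seminorm ℝ (k + 1) (n + 1) Ψ) := by
        have e1 : (0 : ℝ) ≤ 2 ^ (n + k + 1) * SchwartzMap.seminorm ℝ k n Ψ :=
          mul_nonneg (pow_nonneg (by norm_num) _) hp0
        have e2 : (0 : ℝ) ≤ (n * 2 ^ n + 1) * SchwartzMap.seminorm ℝ (k + 1) (n + 1) Ψ :=
          mul_nonneg (by positivity) hp1
        linarith

/-- **Strong continuity of composition operators on `𝓢`**: `L t → 1` in operator norm implies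
`Ψ ∘ L t → Ψ` in the Schwartz topology, for every `Ψ`. -/
theorem tendsto_compCLM_of_tendsto_one {ι : Type*} {l : Filter ι} {L : ι → (E ≃L[ℝ] E)}
    (hLc : Tendsto (fun t => ((L t : E ≃L[ℝ] E) : E →L[ℝ] E)) l (𝓝 1)) (Ψ : 𝓢(E, F)) :
    Tendsto (fun t => SchwartzMap.compCLMOfContinuousLinearEquiv 𝕜 (L t) Ψ) l (𝓝 Ψ) := by
  rw [(schwartz_withSeminorms ℝ E F).tendsto_nhds]
  rintro ⟨k, n⟩ ε hε
  set K : ℝ := 2 ^ (n + k + 1) * SchwartzMap.seminorm ℝ (k + 1) (n + 1) Ψ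
    + n * 2 ^ n * SchwartzMap.seminorm ℝ k n Ψ with hK
  have hK0 : 0 ≤ K := by
    have := apply_nonneg (SchwartzMap.seminorm ℝ (k + 1) (n + 1)) Ψ
    have := apply_nonneg (SchwartzMap.seminorm ℝ k n) Ψ
    positivity
  have h0 := tendsto_iff_norm_sub_tendsto_zero.mp hLc
  have hsmall : ∀ᶠ t in l, ‖((L t : E ≃L[ℝ] E) : E →L[ℝ] E) - 1‖ ≤ 1 / 2 :=
    h0.eventually_le_const (show (0 : ℝ) < 1 / 2 by norm_num)
  have hlt : ∀ᶠ t in l, (K + 1) * ‖((L t : E ≃L[ℝ] E) : E →L[ℝ] E) - 1‖ < ε := by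
    have h := h0.const_mul (K + 1)
    rw [mul_zero] at h
    exact h.eventually_lt_const hε
  filter_upwards [hsmall, hlt] with t ht hlt'
  rw [SchwartzMap.schwartzSeminormFamily_apply]
  calc _ ≤ K * ‖((L t : E ≃L[ℝ] E) : E →L[ℝ] E) - 1‖ := seminorm_compCLM_sub_le Ψ 𝕜 (L t) ht k n
    _ ≤ (K + 1) * ‖((L t : E ≃L[ℝ] E) : E →L[ℝ] E) - 1‖ := by gcongr; linarith
    _ < ε := hlt'

/-- **Linear flow after an arbitrary differentiable trajectory.**  For `L : ℝ → (E ≃L[ℝ] E)` with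
`L 0 = 1`, `HasDerivAt L A 0` (operator norm) and any trajectory `w : ℝ → 𝓢(E, F)` with
`t⁻¹ • (w t - Φ) → Y`, the composite satisfies `t⁻¹ • ((w t) ∘ L t - Φ) → flowGen A Φ + Y`
in `𝓢(E, F)`.  (Typical use: `w t = ` a Heisenberg translation / multiplier family applied to `Φ`,
`L t` a Levi or dilation flow.) -/
theorem tendsto_compCLM_apply_sub_div {L : ℝ → (E ≃L[ℝ] E)} {A : E →L[ℝ] E}
    (hL0 : ((L 0 : E ≃L[ℝ] E) : E →L[ℝ] E) = 1)
    (hL : HasDerivAt (fun s => ((L s : E ≃L[ℝ] E) : E →L[ℝ] E)) A 0)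
    {w : ℝ → 𝓢(E, F)} {Φ Y : 𝓢(E, F)}
    (hw : Tendsto (fun t : ℝ => t⁻¹ • (w t - Φ)) (𝓝[≠] 0) (𝓝 Y)) :
    Tendsto (fun t : ℝ => t⁻¹ • (SchwartzMap.compCLMOfContinuousLinearEquiv 𝕜 (L t) (w t) - Φ))
      (𝓝[≠] 0) (𝓝 (flowGen A Φ + Y)) := by
  have hLc : Tendsto (fun t => ((L t : E ≃L[ℝ] E) : E →L[ℝ] E)) (𝓝[≠] 0) (𝓝 1) := by
    have h := hL.continuousAt.tendsto
    rw [hL0] at h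
    exact h.mono_left nhdsWithin_le_nhds
  have key := tendsto_comp_sub_div
    (U := fun t => (SchwartzMap.compCLMOfContinuousLinearEquiv 𝕜 (L t)).restrictScalars ℝ)
    (w := w) (Φ := Φ) (X := flowGen A Φ) (Y := Y)
    (fun k n => by
      simpa only [ContinuousLinearMap.coe_restrictScalars']
        using eventually_seminorm_compCLM_le (F := F) 𝕜 hLc k n)
    (by simpa only [ContinuousLinearMap.coe_restrictScalars']
        using tendsto_compCLM_of_tendsto_one 𝕜 hLc Y)
    (by simpa only [ContinuousLinearMap.coe_restrictScalars']
        using tendsto_compCLM_sub_div 𝕜 hL0 hL Φ)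
    hw
  simpa only [ContinuousLinearMap.coe_restrictScalars'] using key

/-- Two linear flows composed: `t⁻¹ • (Φ ∘ L₂ t ∘ L₁ t - Φ) → flowGen A₁ Φ + flowGen A₂ Φ` in `𝓢(E, F)`
(note `compCLMOfContinuousLinearEquiv 𝕜 (L₁ t) (compCLMOfContinuousLinearEquiv 𝕜 (L₂ t) Φ) = Φ ∘ L₂ t ∘ L₁ t`). -/
theorem tendsto_compCLM_compCLM_sub_div {L₁ L₂ : ℝ → (E ≃L[ℝ] E)} {A₁ A₂ : E →L[ℝ] E}
    (h₁0 : ((L₁ 0 : E ≃L[ℝ] E) : E →L[ℝ] E) = 1)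
    (h₁ : HasDerivAt (fun s => ((L₁ s : E ≃L[ℝ] E) : E →L[ℝ] E)) A₁ 0)
    (h₂0 : ((L₂ 0 : E ≃L[ℝ] E) : E →L[ℝ] E) = 1)
    (h₂ : HasDerivAt (fun s => ((L₂ s : E ≃L[ℝ] E) : E →L[ℝ] E)) A₂ 0) (Φ : 𝓢(E, F)) :
    Tendsto (fun t : ℝ => t⁻¹ • (SchwartzMap.compCLMOfContinuousLinearEquiv 𝕜 (L₁ t)
        (SchwartzMap.compCLMOfContinuousLinearEquiv 𝕜 (L₂ t) Φ) - Φ))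
      (𝓝[≠] 0) (𝓝 (flowGen A₁ Φ + flowGen A₂ Φ)) :=
  tendsto_compCLM_apply_sub_div 𝕜 h₁0 h₁ (tendsto_compCLM_sub_div 𝕜 h₂0 h₂ Φ)

end Comp

end SchwartzWeil
end HodgeCM
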